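import Literature.Probability.LatticeModels.IsingExponents
import Literature.Probability.LatticeModels.HighDimPointwiseTriviality
import Literature.Probability.LatticeModels.CriticalEtaUpperDCPProofs
import Summits.CriticalPhenomena.Ising3DConformalLimit.Theorems.FKParityRobustnessDefs
import HarnessLib

/-!
# Crux `IndependentStrandsJoin` (stmt-CriticalPhenomena-14625), line `cross-fattening-decoupling` —
# stub `stub_bubble`, Step A: the tetrahedral window bubble on `ℤ³` under two-point regularity

Route `FKParityRobustness`, sub-problem `Ising3DConformalLimit`; registered stub `stub_bubble` of the
skeleton `Cruxes/IndependentStrandsJoin/Lines/cross_fattening_decoupling.lean` (h6 of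
`IndependentStrandsJoin_of`: the window BUBBLE of the two Aizenman–Duminil-Copin tree diagrams is
dominated by the squared double-current window profile).  The unconditional stub is an open two-sided
regularity problem for the critical two-point function of `ℤ³`; this file proves its lattice
(infinite-volume) content CONDITIONALLY on the named fact
`Literature.Probability.LatticeModels.HasIsingEtaBounds 3 η` (`c‖x‖^{-(1+η)} ≤ ⟨σ₀σ_x⟩_{β_c} ≤ C‖x‖^{-(1+η)}`,
ADC 2021 Assumption 4.1) with `0 ≤ η < 1/2` (Duminil-Copin–Panis 2025: `η ≤ 1/2` conditionally on the
existence of `η`; at `η = 1/2` the ratio below is `log l`, and in `d = 4`, `η = 0`, the bubble is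
log-divergent — ADC 2021 §4 — so this is where `d = 3` enters the line).

**`bubble_lattice` (Step A).**  `τ = criticalTwoPoint 3`, `K x y = τ(y - x)`, `A = l·tetra`,
`W_l = Λ_{⌊l/2⌋}`: there is `C > 0` with, for every `l ≥ 1`, `S(l) := Σ_{u ∈ W_l} K(A₀,u)K(u,A₁)K(A₂,u)K(u,A₃) > 0`
and `2·K(A₀,A₁)K(A₂,A₃)·Σ_{v,w ∈ W_l} T₁T₂ ≤ C·S(l)²`, `T₁(v,w) = K(A₀,v)K(v,w)K(w,A₁) + K(A₀,w)K(w,v)K(v,A₁)`.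
Power counting (ADC 2021 §4 / Lemma 4.4): for `v ∈ W_l`, `l/2 ≤ ‖A_i - v‖_∞ ≤ 2l` (`bubble_geom`), so
every source factor lies in `[c₁(2l)^{-κ}, C₁(l/2)^{-κ}]`, `κ = 1 + η`; hence `S ≥ l³(c₁2^{-κ}l^{-κ})⁴`
(`bubble_profile_lower`), `Σ T₁T₂ ≤ 4U⁴ Σ_{v,w} K(v,w)²`, `U = C₁2^κl^{-κ}` (`bubble_bubbleSum_upper`),
`Σ_{v,w ∈ W_l} τ(w-v)² ≤ 8l³·(1 + 54C₁²/(1-2η))·l^{1-2η}` (`bubble_sqSum_le`: shells `|∂Λ_m| ≤ 54m²` and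
`Σ_{k ≤ l} k^{-2η} ≤ l^{1-2η}/(1-2η)`); both sides are `≍ l^{-2-8η}` (`bubble_algebra`).  The factor `2`
is the room consumed by the box transfer (Step B, `…StubBubble.lean`, landing `stub_bubble_of_etaBounds`).
Theorem-only file; helpers carry the prefix `bubble_`.

References: M. Aizenman, H. Duminil-Copin, Ann. of Math. 194 (2021), arXiv:1912.07973, §4, Lemma 4.4,
Assumption 4.1 [AizenmanDuminilCopinAnnals2021]; H. Duminil-Copin, R. Panis, CMP 406 (2025),
arXiv:2404.05700, Thm. 1.5 [DuminilCopinPanis2025LowerBounds].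
-/
noncomputable section

open Finset Filter Topology
open Literature.Probability.LatticeModels
open Summit.CriticalPhenomena.Ising3DConformalLimit.Cruxes.ParityRobustMerging.PlaquetteXorSurgery
  (tetra tetra_inj)

namespace Summit.CriticalPhenomena.Ising3DConformalLimit.Theorems

/-! ### Geometry of the dilated tetrahedron and its central window -/

/-- Every coordinate of every vertex of the route's tetrahedron is `±1`. -/
theorem bubble_tetra_apply (i : Fin 4) (j : Fin 3) : tetra i j = 1 ∨ tetra i j = -1 := by
  revert i j; unfold tetra; decide

/-- Two distinct vertices of the tetrahedron differ by `±2` in some coordinate. -/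
theorem bubble_tetra_sub {i j : Fin 4} (hij : i ≠ j) :
    ∃ k : Fin 3, tetra i k - tetra j k = 2 ∨ tetra i k - tetra j k = -2 := by
  revert i j; unfold tetra; decide

/-- Window geometry: for `v` in the central window `Λ_{⌊l/2⌋}` and a source `A_i = l·tetra i`,
`A_i - v ≠ 0` and `l/2 ≤ ‖A_i - v‖_∞ ≤ 2l`. -/
theorem bubble_geom {l : ℕ} (hl : 1 ≤ l) {v : Site 3} (hv : v ∈ box 3 (l / 2)) (i : Fin 4) :
    (l : ℤ) • tetra i - v ≠ 0 ∧ (l : ℝ) ≤ 2 * ‖(l : ℤ) • tetra i - v‖ ∧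
      ‖(l : ℤ) • tetra i - v‖ ≤ 2 * l := by
  set x : Site 3 := (l : ℤ) • tetra i - v with hx
  have hcoord : ∀ j, l ≤ 2 * (x j).natAbs ∧ (x j).natAbs ≤ 2 * l := by
    intro j
    have hxj : x j = (l : ℤ) * tetra i j - v j := by simp [hx, Pi.sub_apply]
    have hvj := (mem_box.1 hv) j
    rcases bubble_tetra_apply i j with h | h <;> rw [hxj, h] <;> omega
  rw [Site.norm_eq_supNorm]
  have h1 : l ≤ 2 * Site.supNorm x :=
    (hcoord 0).1.trans (Nat.mul_le_mul_left 2 (Site.natAbs_le_supNorm x 0))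
  have h2 : Site.supNorm x ≤ 2 * l := Site.supNorm_le_iff.2 fun j => (hcoord j).2
  refine ⟨fun h0 => ?_, by exact_mod_cast h1, by exact_mod_cast h2⟩
  have : Site.supNorm x = 0 := Site.supNorm_eq_zero_iff.2 h0
  omega

/-- Source geometry: two distinct sources `A_i = l·tetra i`, `A_j` satisfy `A_i - A_j ≠ 0` and
`l ≤ 2‖A_i - A_j‖_∞` (indeed `‖A_i - A_j‖_∞ = 2l`). -/
theorem bubble_geom_src {l : ℕ} (hl : 1 ≤ l) {i j : Fin 4} (hij : i ≠ j) :
    (l : ℤ) • tetra i - (l : ℤ) • tetra j ≠ 0 ∧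
      (l : ℝ) ≤ 2 * ‖(l : ℤ) • tetra i - (l : ℤ) • tetra j‖ := by
  set x : Site 3 := (l : ℤ) • tetra i - (l : ℤ) • tetra j with hx
  obtain ⟨k, hk⟩ := bubble_tetra_sub hij
  have hxk : x k = (l : ℤ) * (tetra i k - tetra j k) := by simp [hx, Pi.sub_apply, mul_sub]
  have hk' : l ≤ (x k).natAbs := by
    rcases hk with h | h <;> rw [hxk, h] <;> omega
  have h1 : l ≤ Site.supNorm x := hk'.trans (Site.natAbs_le_supNorm x k)
  rw [Site.norm_eq_supNorm]
  refine ⟨fun h0 => ?_, ?_⟩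
  · have : Site.supNorm x = 0 := Site.supNorm_eq_zero_iff.2 h0; omega
  · have : (l : ℝ) ≤ Site.supNorm x := mod_cast h1
    linarith

/-! ### Source factors under the power bounds -/

/-- Upper source factor: `τ(x) ≤ C₁‖x‖^{-κ}` and `l ≤ 2‖x‖` give `τ(x) ≤ C₁ 2^κ l^{-κ}`. -/
theorem bubble_factor_upper {τ : Site 3 → ℝ} {C₁ κ : ℝ} {l : ℕ} (hl : 1 ≤ l) (hκ : 0 ≤ κ)
    (hC₁ : 0 ≤ C₁) (hup : ∀ x : Site 3, x ≠ 0 → τ x ≤ C₁ * ‖x‖ ^ (-κ)) {x : Site 3} (hx0 : x ≠ 0)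
    (hlo : (l : ℝ) ≤ 2 * ‖x‖) : τ x ≤ C₁ * (2 : ℝ) ^ κ * (l : ℝ) ^ (-κ) := by
  have hn : 0 < ‖x‖ := norm_pos_iff.2 hx0
  have hlpos : (0 : ℝ) < l := by exact_mod_cast hl
  have h1 : (2 * ‖x‖) ^ (-κ) ≤ (l : ℝ) ^ (-κ) := Real.rpow_le_rpow_of_nonpos hlpos hlo (by linarith)
  have h2 : ‖x‖ ^ (-κ) = (2 : ℝ) ^ κ * (2 * ‖x‖) ^ (-κ) := by
    rw [Real.mul_rpow (by norm_num) hn.le, ← mul_assoc, Real.rpow_neg (by norm_num : (0:ℝ) ≤ 2),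
      mul_inv_cancel₀ (Real.rpow_pos_of_pos (by norm_num) κ).ne', one_mul]
  calc τ x ≤ C₁ * ‖x‖ ^ (-κ) := hup x hx0
    _ = C₁ * (2 : ℝ) ^ κ * (2 * ‖x‖) ^ (-κ) := by rw [h2, mul_assoc]
    _ ≤ C₁ * (2 : ℝ) ^ κ * (l : ℝ) ^ (-κ) := mul_le_mul_of_nonneg_left h1 (by positivity)

/-- Lower source factor: `c₁‖x‖^{-κ} ≤ τ(x)` and `‖x‖ ≤ 2l` give `c₁ 2^{-κ} l^{-κ} ≤ τ(x)`. -/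
theorem bubble_factor_lower {τ : Site 3 → ℝ} {c₁ κ : ℝ} {l : ℕ} (hκ : 0 ≤ κ) (hc₁ : 0 ≤ c₁)
    (hlow : ∀ x : Site 3, x ≠ 0 → c₁ * ‖x‖ ^ (-κ) ≤ τ x) {x : Site 3} (hx0 : x ≠ 0)
    (hhi : ‖x‖ ≤ 2 * l) : c₁ * (2 : ℝ) ^ (-κ) * (l : ℝ) ^ (-κ) ≤ τ x := by
  have hn : 0 < ‖x‖ := norm_pos_iff.2 hx0
  have h1 : (2 * (l : ℝ)) ^ (-κ) ≤ ‖x‖ ^ (-κ) := Real.rpow_le_rpow_of_nonpos hn hhi (by linarith)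
  rw [mul_assoc, ← Real.mul_rpow (by norm_num) (Nat.cast_nonneg l)]
  exact (mul_le_mul_of_nonneg_left h1 hc₁).trans (hlow x hx0)

/-! ### The two elementary inequalities of the power counting (any finite window, any kernel) -/

/-- Profile from below: if the four source factors are `≥ D ≥ 0` on `W` then
`Σ_{u ∈ W} p·q·(r·s) ≥ #W · D⁴`. -/
theorem bubble_profile_lower {α : Type*} (W : Finset α) {p q r s : α → ℝ} {D : ℝ} (hD : 0 ≤ D)
    (hp : ∀ u ∈ W, D ≤ p u) (hq : ∀ u ∈ W, D ≤ q u) (hr : ∀ u ∈ W, D ≤ r u)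
    (hs : ∀ u ∈ W, D ≤ s u) :
    (#W : ℝ) * D ^ 4 ≤ ∑ u ∈ W, p u * q u * (r u * s u) := by
  calc (#W : ℝ) * D ^ 4 = ∑ _u ∈ W, D ^ 4 := by rw [Finset.sum_const, nsmul_eq_mul]
    _ ≤ ∑ u ∈ W, p u * q u * (r u * s u) := Finset.sum_le_sum fun u hu => by
        have hD2 : 0 ≤ D * D := mul_nonneg hD hD
        calc D ^ 4 = D * D * (D * D) := by ring
          _ ≤ p u * q u * (r u * s u) :=
            mul_le_mul (mul_le_mul (hp u hu) (hq u hu) hD (hD.trans (hp u hu)))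
              (mul_le_mul (hr u hu) (hs u hu) hD (hD.trans (hr u hu))) hD2
              (mul_nonneg (hD.trans (hp u hu)) (hD.trans (hq u hu)))

/-- Bubble from above: if the four source factors lie in `[0, U]` on `W` and the pair kernel `k` is
`≥ 0`, each ADC tree is `≤ U²(k(v,w) + k(w,v))`, so the window bubble is
`≤ U⁴ Σ (k(v,w)+k(w,v))² ≤ 4U⁴ Σ_{v,w ∈ W} k(v,w)²` (Cauchy–Schwarz on the two orientations and
`Finset.sum_comm`). -/
theorem bubble_bubbleSum_upper {α : Type*} (W : Finset α) {p q r s : α → ℝ} {k : α → α → ℝ}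
    {U : ℝ} (hk : ∀ v w, 0 ≤ k v w)
    (hp0 : ∀ u ∈ W, 0 ≤ p u) (hq0 : ∀ u ∈ W, 0 ≤ q u) (hr0 : ∀ u ∈ W, 0 ≤ r u)
    (hs0 : ∀ u ∈ W, 0 ≤ s u) (hp : ∀ u ∈ W, p u ≤ U) (hq : ∀ u ∈ W, q u ≤ U)
    (hr : ∀ u ∈ W, r u ≤ U) (hs : ∀ u ∈ W, s u ≤ U) :
    ∑ v ∈ W, ∑ w ∈ W, (p v * k v w * q w + p w * k w v * q v) * (r v * k v w * s w + r w * k w v * s v)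
      ≤ 4 * U ^ 4 * ∑ v ∈ W, ∑ w ∈ W, k v w ^ 2 := by
  have tree : ∀ {f g : α → ℝ}, (∀ u ∈ W, 0 ≤ f u) → (∀ u ∈ W, 0 ≤ g u) → (∀ u ∈ W, f u ≤ U) →
      (∀ u ∈ W, g u ≤ U) → ∀ v ∈ W, ∀ w ∈ W,
      0 ≤ f v * k v w * g w + f w * k w v * g v ∧
        f v * k v w * g w + f w * k w v * g v ≤ U ^ 2 * (k v w + k w v) := by
    intro f g hf0 hg0 hf hg v hv w hw
    have hU : 0 ≤ U := (hf0 v hv).trans (hf v hv)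
    refine ⟨add_nonneg (mul_nonneg (mul_nonneg (hf0 v hv) (hk v w)) (hg0 w hw))
      (mul_nonneg (mul_nonneg (hf0 w hw) (hk w v)) (hg0 v hv)), ?_⟩
    have h1 : f v * k v w * g w ≤ U * k v w * U :=
      mul_le_mul (mul_le_mul_of_nonneg_right (hf v hv) (hk v w)) (hg w hw) (hg0 w hw)
        (mul_nonneg hU (hk v w))
    have h2 : f w * k w v * g v ≤ U * k w v * U :=
      mul_le_mul (mul_le_mul_of_nonneg_right (hf w hw) (hk w v)) (hg v hv) (hg0 v hv)
        (mul_nonneg hU (hk w v))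
    calc f v * k v w * g w + f w * k w v * g v ≤ U * k v w * U + U * k w v * U := add_le_add h1 h2
      _ = U ^ 2 * (k v w + k w v) := by ring
  have hterm : ∀ v ∈ W, ∀ w ∈ W,
      (p v * k v w * q w + p w * k w v * q v) * (r v * k v w * s w + r w * k w v * s v)
        ≤ 2 * U ^ 4 * (k v w ^ 2 + k w v ^ 2) := by
    intro v hv w hw
    obtain ⟨h10, h1⟩ := tree hp0 hq0 hp hq v hv w hw
    obtain ⟨h20, h2⟩ := tree hr0 hs0 hr hs v hv w hw
    have hUk : 0 ≤ U ^ 2 * (k v w + k w v) := h10.trans h1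
    calc (p v * k v w * q w + p w * k w v * q v) * (r v * k v w * s w + r w * k w v * s v)
        ≤ (U ^ 2 * (k v w + k w v)) * (U ^ 2 * (k v w + k w v)) := mul_le_mul h1 h2 h20 hUk
      _ = U ^ 4 * (k v w + k w v) ^ 2 := by ring
      _ ≤ U ^ 4 * (2 * (k v w ^ 2 + k w v ^ 2)) :=
          mul_le_mul_of_nonneg_left (by nlinarith [sq_nonneg (k v w - k w v)]) (by positivity)
      _ = 2 * U ^ 4 * (k v w ^ 2 + k w v ^ 2) := by ring
  have hswap : ∑ v ∈ W, ∑ w ∈ W, k w v ^ 2 = ∑ v ∈ W, ∑ w ∈ W, k v w ^ 2 := Finset.sum_comm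
  calc ∑ v ∈ W, ∑ w ∈ W, (p v * k v w * q w + p w * k w v * q v) * (r v * k v w * s w + r w * k w v * s v)
      ≤ ∑ v ∈ W, ∑ w ∈ W, 2 * U ^ 4 * (k v w ^ 2 + k w v ^ 2) :=
        Finset.sum_le_sum fun v hv => Finset.sum_le_sum fun w hw => hterm v hv w hw
    _ = 2 * U ^ 4 * (∑ v ∈ W, ∑ w ∈ W, k v w ^ 2 + ∑ v ∈ W, ∑ w ∈ W, k w v ^ 2) := by
        simp only [Finset.mul_sum, Finset.sum_add_distrib, mul_add]
    _ = 4 * U ^ 4 * ∑ v ∈ W, ∑ w ∈ W, k v w ^ 2 := by rw [hswap]; ring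

/-! ### The one `d = 3`, `η < 1/2` input: the pair kernel summed in squares over a box -/

/-- `Σ_{‖z‖_∞ ≤ l} τ(z)² ≤ (1 + 54C₁²/(1-2η))·l^{1-2η}` for `τ(0) = 1`, `0 ≤ τ`,
`τ(z) ≤ C₁‖z‖^{-κ}` (`z ≠ 0`), `κ = 1 + η`, `0 ≤ η < 1/2`, `l ≥ 1`: shells `|∂Λ_m| ≤ 54m²`
(`sum_box_erase_norm_rpow_le`) and `Σ_{k ≤ l} k^{-2η} ≤ l^{1-2η}/(1-2η)` (`sum_Icc_rpow_sub_one_le`) — the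
window bubble `Σ_{r ≤ l} r²·r^{-2-2η} ≍ l^{1-2η}`, finite against the window mean iff `η < 1/2` (ADC 2021 §4). -/
theorem bubble_sqSum_le {τ : Site 3 → ℝ} {C₁ κ η : ℝ} (hκ : κ = 1 + η) (hη0 : 0 ≤ η)
    (hη2 : η < 1 / 2) (hτ0 : τ 0 = 1) (hτnn : ∀ x, 0 ≤ τ x)
    (hup : ∀ x : Site 3, x ≠ 0 → τ x ≤ C₁ * ‖x‖ ^ (-κ)) {l : ℕ} (hl : 1 ≤ l) :
    ∑ z ∈ box 3 l, τ z ^ 2 ≤ (1 + 54 * C₁ ^ 2 / (1 - 2 * η)) * (l : ℝ) ^ (1 - 2 * η) := by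
  have hp0 : 0 < 1 - 2 * η := by linarith
  have hp1 : 1 - 2 * η ≤ 1 := by linarith
  have hl1 : (1 : ℝ) ≤ l := by exact_mod_cast hl
  rw [← Finset.add_sum_erase _ _ (zero_mem_box 3 l), hτ0, one_pow]
  have h1 : ∑ z ∈ (box 3 l).erase 0, τ z ^ 2 ≤
      C₁ ^ 2 * ∑ z ∈ (box 3 l).erase 0, ‖z‖ ^ (-(2 * κ)) := by
    rw [Finset.mul_sum]
    refine Finset.sum_le_sum fun z hz => ?_
    have hz0 : z ≠ 0 := (Finset.mem_erase.1 hz).1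
    have hnpos : 0 < ‖z‖ := norm_pos_iff.2 hz0
    have hsq : (‖z‖ ^ (-κ)) ^ 2 = ‖z‖ ^ (-(2 * κ)) := by
      rw [← Real.rpow_natCast, ← Real.rpow_mul hnpos.le]; congr 1; push_cast; ring
    calc τ z ^ 2 ≤ (C₁ * ‖z‖ ^ (-κ)) ^ 2 := pow_le_pow_left₀ (hτnn z) (hup z hz0) 2
      _ = C₁ ^ 2 * ‖z‖ ^ (-(2 * κ)) := by rw [mul_pow, hsq]
  have h2 : ∑ z ∈ (box 3 l).erase 0, ‖z‖ ^ (-(2 * κ)) ≤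
      54 * ∑ m ∈ Finset.range l, ((m : ℝ) + 1) ^ (2 - 2 * κ) := sum_box_erase_norm_rpow_le (2 * κ) l
  have h3 : ∑ m ∈ Finset.range l, ((m : ℝ) + 1) ^ (2 - 2 * κ) ≤
      (l : ℝ) ^ (1 - 2 * η) / (1 - 2 * η) := by
    have h := sum_Icc_rpow_sub_one_le hp0 hp1 l
    rw [← Finset.Ico_add_one_right_eq_Icc, Finset.sum_Ico_eq_sum_range, Nat.add_sub_cancel] at h
    rw [show 2 - 2 * κ = (1 - 2 * η) - 1 by rw [hκ]; ring]
    convert h using 3 with m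
    push_cast; ring
  have h4 : (1 : ℝ) ≤ (l : ℝ) ^ (1 - 2 * η) := Real.one_le_rpow hl1 hp0.le
  have hC2 : 0 ≤ C₁ ^ 2 := sq_nonneg _
  calc 1 + ∑ z ∈ (box 3 l).erase 0, τ z ^ 2
      ≤ 1 + C₁ ^ 2 * (54 * ((l : ℝ) ^ (1 - 2 * η) / (1 - 2 * η))) := by
        have := mul_le_mul_of_nonneg_left (h2.trans (mul_le_mul_of_nonneg_left h3 (by norm_num)))
          hC2
        linarith
    _ ≤ (l : ℝ) ^ (1 - 2 * η) + C₁ ^ 2 * (54 * ((l : ℝ) ^ (1 - 2 * η) / (1 - 2 * η))) := by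
        linarith
    _ = (1 + 54 * C₁ ^ 2 / (1 - 2 * η)) * (l : ℝ) ^ (1 - 2 * η) := by
        rw [div_eq_mul_inv, div_eq_mul_inv]; ring

/-! ### Exponent bookkeeping -/

/-- The real arithmetic of the power counting: with `U = C₁·A·P`, `D = c₁·A'·P` (`P = l^{-κ}`,
`A = 2^κ`, `A' = 2^{-κ}`), `Z₀₁, Z₂₃ ∈ [0, U]`, `B ≤ 4U⁴Q`, `Q ≤ 8L₃·K₀X`, `S ≥ L₃D⁴` and the
exponent identity `P²L₃ = X` (`(l^{-κ})²·l³ = l^{1-2η}`), one gets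
`2·Z₀₁Z₂₃B ≤ (64K₀C₁⁶A⁶/(c₁⁸A'⁸))·S²` — both sides are `∝ P⁸L₃²`. -/
theorem bubble_algebra {Z01 Z23 B Q S P L3 X K₀ c₁ C₁ A A' : ℝ} (hc₁ : 0 < c₁) (hA' : 0 < A')
    (hA : 0 ≤ A) (hC₁ : 0 ≤ C₁) (hP : 0 ≤ P) (hK₀ : 0 ≤ K₀) (hL3 : 0 ≤ L3) (hX0 : 0 ≤ X)
    (hX : P ^ 2 * L3 = X)
    (hZ01 : 0 ≤ Z01) (hZ01U : Z01 ≤ C₁ * A * P) (hZ23 : 0 ≤ Z23) (hZ23U : Z23 ≤ C₁ * A * P)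
    (hB : B ≤ 4 * (C₁ * A * P) ^ 4 * Q) (hQ : Q ≤ 8 * L3 * (K₀ * X))
    (hS : L3 * (c₁ * A' * P) ^ 4 ≤ S) :
    2 * (Z01 * Z23 * B) ≤ 64 * K₀ * C₁ ^ 6 * A ^ 6 / (c₁ ^ 8 * A' ^ 8) * S ^ 2 := by
  set U := C₁ * A * P with hU
  set D := c₁ * A' * P with hD
  have hU0 : 0 ≤ U := by positivity
  have hU4 : 0 ≤ 4 * U ^ 4 := by positivity
  have hbound : 0 ≤ 4 * U ^ 4 * (8 * L3 * (K₀ * X)) := by positivity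
  have h1 : Z01 * Z23 * B ≤ U * U * (4 * U ^ 4 * (8 * L3 * (K₀ * X))) := by
    have hB' : B ≤ 4 * U ^ 4 * (8 * L3 * (K₀ * X)) := hB.trans (mul_le_mul_of_nonneg_left hQ hU4)
    calc Z01 * Z23 * B ≤ Z01 * Z23 * (4 * U ^ 4 * (8 * L3 * (K₀ * X))) :=
          mul_le_mul_of_nonneg_left hB' (mul_nonneg hZ01 hZ23)
      _ ≤ U * U * (4 * U ^ 4 * (8 * L3 * (K₀ * X))) :=
          mul_le_mul_of_nonneg_right (mul_le_mul hZ01U hZ23U hZ23 hU0) hbound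
  have h2 : (L3 * D ^ 4) ^ 2 ≤ S ^ 2 := pow_le_pow_left₀ (by positivity) hS 2
  have hcst : 0 ≤ 64 * K₀ * C₁ ^ 6 * A ^ 6 / (c₁ ^ 8 * A' ^ 8) := by positivity
  calc 2 * (Z01 * Z23 * B) ≤ 2 * (U * U * (4 * U ^ 4 * (8 * L3 * (K₀ * X)))) := by linarith
    _ = 64 * K₀ * C₁ ^ 6 * A ^ 6 / (c₁ ^ 8 * A' ^ 8) * (L3 * D ^ 4) ^ 2 := by
        rw [hU, hD, ← hX]
        field_simp
        ring
    _ ≤ 64 * K₀ * C₁ ^ 6 * A ^ 6 / (c₁ ^ 8 * A' ^ 8) * S ^ 2 := mul_le_mul_of_nonneg_left h2 hcst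

/-! ### Step A: the window bubble against the squared window profile on `ℤ³` -/

/-- **Step A of stub `stub_bubble` (line `cross-fattening-decoupling`, crux `IndependentStrandsJoin`),
conditional on `HasIsingEtaBounds 3 η`, `0 ≤ η < 1/2`.**  For the kernel `K(x,y) = ⟨σ_xσ_y⟩_{β_c} =
criticalTwoPoint 3 (y - x)` of `ℤ³`, the sources `A = l·tetra` and the central window `W_l = Λ_{⌊l/2⌋}`
there is ONE constant `C > 0` such that for every `l ≥ 1` the window profile
`S(l) = Σ_{u ∈ W_l} K(A₀,u)K(u,A₁)K(A₂,u)K(u,A₃)` is positive and the tetrahedral window bubble obeys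
`2·K(A₀,A₁)K(A₂,A₃)·Σ_{v,w ∈ W_l} T₁(v,w)T₂(v,w) ≤ C·S(l)²` (ADC 2021, Lemma 4.4 power counting in
`d = 3`: both sides `≍ l^{-2-8η}`).  The kernel is passed as any `K` with `K x y = criticalTwoPoint 3 (y-x)`
so that the box transfer can instantiate it verbatim. -/
theorem bubble_lattice :
    ∀ {η : ℝ}, HasIsingEtaBounds 3 η → 0 ≤ η → η < 1 / 2 →
    ∀ {K : Site 3 → Site 3 → ℝ}, (∀ x y, K x y = criticalTwoPoint 3 (y - x)) →
    ∃ C : ℝ, 0 < C ∧ ∀ l : ℕ, 1 ≤ l → ∀ A : Fin 4 → Site 3, (∀ i, A i = (l : ℤ) • tetra i) →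
      0 < ∑ u ∈ box 3 (l / 2), K (A 0) u * K u (A 1) * (K (A 2) u * K u (A 3)) ∧
      2 * (K (A 0) (A 1) * K (A 2) (A 3) *
          ∑ v ∈ box 3 (l / 2), ∑ w ∈ box 3 (l / 2),
            (K (A 0) v * K v w * K w (A 1) + K (A 0) w * K w v * K v (A 1)) *
            (K (A 2) v * K v w * K w (A 3) + K (A 2) w * K w v * K v (A 3)))
        ≤ C * (∑ u ∈ box 3 (l / 2), K (A 0) u * K u (A 1) * (K (A 2) u * K u (A 3))) ^ 2 := by
  intro η hη hη0 hη2 K hK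
  obtain ⟨c₁, C₁', hc₁, hb⟩ := hη
  set κ : ℝ := ((3 : ℕ) : ℝ) - 2 + η with hκdef
  have hκ : κ = 1 + η := by rw [hκdef]; push_cast; ring
  have hκ0 : 0 ≤ κ := by rw [hκ]; linarith
  set C₁ : ℝ := max C₁' 1 with hC₁def
  have hC₁ : 0 ≤ C₁ := zero_le_one.trans (le_max_right _ _)
  have hlow : ∀ x : Site 3, x ≠ 0 → c₁ * ‖x‖ ^ (-κ) ≤ criticalTwoPoint 3 x := fun x hx => (hb x hx).1
  have hup : ∀ x : Site 3, x ≠ 0 → criticalTwoPoint 3 x ≤ C₁ * ‖x‖ ^ (-κ) := fun x hx =>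
    (hb x hx).2.trans (mul_le_mul_of_nonneg_right (le_max_left _ _) (Real.rpow_nonneg (norm_nonneg _) _))
  set A2 : ℝ := (2 : ℝ) ^ κ with hA2
  set A2' : ℝ := (2 : ℝ) ^ (-κ) with hA2'
  have hA2pos : 0 < A2 := Real.rpow_pos_of_pos (by norm_num) _
  have hA2'pos : 0 < A2' := Real.rpow_pos_of_pos (by norm_num) _
  set K₀ : ℝ := 1 + 54 * C₁ ^ 2 / (1 - 2 * η) with hK₀
  have h12 : 0 < 1 - 2 * η := by linarith
  have hK₀0 : 0 ≤ K₀ := by positivity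
  refine ⟨64 * K₀ * C₁ ^ 6 * A2 ^ 6 / (c₁ ^ 8 * A2' ^ 8), ?_, fun l hl A hA => ?_⟩
  · have hC₁pos : 0 < C₁ := zero_lt_one.trans_le (le_max_right _ _)
    positivity
  set W := box 3 (l / 2) with hW
  set P : ℝ := (l : ℝ) ^ (-κ) with hP
  have hlpos : (0 : ℝ) < l := by exact_mod_cast hl
  have hP0 : 0 ≤ P := Real.rpow_nonneg hlpos.le _
  -- source factors on the window
  have hsrc : ∀ i, ∀ u ∈ W, (c₁ * A2' * P ≤ K (A i) u ∧ K (A i) u ≤ C₁ * A2 * P) ∧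
      (c₁ * A2' * P ≤ K u (A i) ∧ K u (A i) ≤ C₁ * A2 * P) := by
    intro i u hu
    obtain ⟨h0, hlo, hhi⟩ := bubble_geom hl hu i
    rw [← hA i] at h0 hlo hhi
    have h0' : u - A i ≠ 0 := fun h => h0 (by rw [← neg_sub, h, neg_zero])
    have hlo' : (l : ℝ) ≤ 2 * ‖u - A i‖ := by rwa [norm_sub_rev]
    have hhi' : ‖u - A i‖ ≤ 2 * l := by rwa [norm_sub_rev]
    simp only [hK]
    exact ⟨⟨bubble_factor_lower hκ0 hc₁.le hlow h0' hhi', bubble_factor_upper hl hκ0 hC₁ hup h0' hlo'⟩,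
      ⟨bubble_factor_lower hκ0 hc₁.le hlow h0 hhi, bubble_factor_upper hl hκ0 hC₁ hup h0 hlo⟩⟩
  -- the two source pairs
  have hpair : ∀ {i j : Fin 4}, i ≠ j → 0 ≤ K (A i) (A j) ∧ K (A i) (A j) ≤ C₁ * A2 * P := by
    intro i j hij
    obtain ⟨h0, hlo⟩ := bubble_geom_src hl hij.symm
    rw [hK, hA i, hA j]
    exact ⟨criticalTwoPoint_nonneg' _, bubble_factor_upper hl hκ0 hC₁ hup h0 hlo⟩
  -- window cardinality `l³ ≤ #W_l ≤ 8l³`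
  have hW1 : (l : ℝ) ^ 3 ≤ #W := by
    rw [hW, card_box]; push_cast
    have : (l : ℝ) ≤ 2 * ((l / 2 : ℕ) : ℝ) + 1 := by
      have : l ≤ 2 * (l / 2) + 1 := by omega
      exact_mod_cast this
    exact pow_le_pow_left₀ hlpos.le this 3
  have hW2 : (#W : ℝ) ≤ 8 * (l : ℝ) ^ 3 := by
    rw [hW, card_box]; push_cast
    have : (2 * ((l / 2 : ℕ) : ℝ) + 1) ≤ 2 * l := by
      have : 2 * (l / 2) + 1 ≤ 2 * l := by omega
      exact_mod_cast this
    calc (2 * ((l / 2 : ℕ) : ℝ) + 1) ^ 3 ≤ (2 * (l : ℝ)) ^ 3 := pow_le_pow_left₀ (by positivity) this 3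
      _ = 8 * (l : ℝ) ^ 3 := by ring
  -- the pair kernel summed in squares over the window
  have hQ : ∑ v ∈ W, ∑ w ∈ W, K v w ^ 2 ≤ 8 * (l : ℝ) ^ 3 * (K₀ * (l : ℝ) ^ (1 - 2 * η)) := by
    have hin : ∀ v ∈ W, ∑ w ∈ W, K v w ^ 2 ≤ K₀ * (l : ℝ) ^ (1 - 2 * η) := by
      intro v hv
      have hsub : W.image (fun w => w - v) ⊆ box 3 l := by
        intro z hz
        rw [Finset.mem_image] at hz
        obtain ⟨w, hw, rfl⟩ := hz
        rw [hW, mem_box] at hw hv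
        rw [mem_box]
        intro i
        have h1 := hw i
        have h2 := hv i
        simp only [Pi.sub_apply]
        constructor <;> omega
      calc ∑ w ∈ W, K v w ^ 2 = ∑ w ∈ W, criticalTwoPoint 3 (w - v) ^ 2 := by simp only [hK]
        _ = ∑ z ∈ W.image (fun w => w - v), criticalTwoPoint 3 z ^ 2 :=
            (Finset.sum_image (f := fun z => criticalTwoPoint 3 z ^ 2) sub_left_injective.injOn).symm
        _ ≤ ∑ z ∈ box 3 l, criticalTwoPoint 3 z ^ 2 :=
            Finset.sum_le_sum_of_subset_of_nonneg hsub fun _ _ _ => sq_nonneg _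
        _ ≤ K₀ * (l : ℝ) ^ (1 - 2 * η) :=
            bubble_sqSum_le hκ hη0 hη2 criticalTwoPoint_zero' criticalTwoPoint_nonneg' hup hl
    have hKX : 0 ≤ K₀ * (l : ℝ) ^ (1 - 2 * η) := mul_nonneg hK₀0 (Real.rpow_nonneg hlpos.le _)
    calc ∑ v ∈ W, ∑ w ∈ W, K v w ^ 2 ≤ ∑ _v ∈ W, K₀ * (l : ℝ) ^ (1 - 2 * η) := Finset.sum_le_sum hin
      _ = #W * (K₀ * (l : ℝ) ^ (1 - 2 * η)) := by rw [Finset.sum_const, nsmul_eq_mul]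
      _ ≤ 8 * (l : ℝ) ^ 3 * (K₀ * (l : ℝ) ^ (1 - 2 * η)) := mul_le_mul_of_nonneg_right hW2 hKX
  -- the bubble against the pair kernel
  have hB := bubble_bubbleSum_upper W (k := K) (U := C₁ * A2 * P)
    (p := fun u => K (A 0) u) (q := fun u => K u (A 1)) (r := fun u => K (A 2) u)
    (s := fun u => K u (A 3))
    (fun v w => by rw [hK]; exact criticalTwoPoint_nonneg' _)
    (fun u hu => (by positivity : 0 ≤ c₁ * A2' * P).trans ((hsrc 0 u hu).1.1))
    (fun u hu => (by positivity : 0 ≤ c₁ * A2' * P).trans ((hsrc 1 u hu).2.1))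
    (fun u hu => (by positivity : 0 ≤ c₁ * A2' * P).trans ((hsrc 2 u hu).1.1))
    (fun u hu => (by positivity : 0 ≤ c₁ * A2' * P).trans ((hsrc 3 u hu).2.1))
    (fun u hu => (hsrc 0 u hu).1.2) (fun u hu => (hsrc 1 u hu).2.2)
    (fun u hu => (hsrc 2 u hu).1.2) (fun u hu => (hsrc 3 u hu).2.2)
  -- the profile from below
  have hS := bubble_profile_lower W (D := c₁ * A2' * P) (by positivity)
    (p := fun u => K (A 0) u) (q := fun u => K u (A 1)) (r := fun u => K (A 2) u)
    (s := fun u => K u (A 3))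
    (fun u hu => (hsrc 0 u hu).1.1) (fun u hu => (hsrc 1 u hu).2.1)
    (fun u hu => (hsrc 2 u hu).1.1) (fun u hu => (hsrc 3 u hu).2.1)
  have hD4 : 0 ≤ (c₁ * A2' * P) ^ 4 := by positivity
  have hS' : (l : ℝ) ^ 3 * (c₁ * A2' * P) ^ 4 ≤
      ∑ u ∈ W, K (A 0) u * K u (A 1) * (K (A 2) u * K u (A 3)) :=
    (mul_le_mul_of_nonneg_right hW1 hD4).trans hS
  -- exponents: `(l^{-κ})²·l³ = l^{1-2η}`
  have hX : P ^ 2 * (l : ℝ) ^ 3 = (l : ℝ) ^ (1 - 2 * η) := by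
    rw [hP, ← Real.rpow_natCast, ← Real.rpow_mul hlpos.le, ← Real.rpow_natCast (l : ℝ) 3,
      ← Real.rpow_add hlpos]
    congr 1; rw [hκ]; push_cast; ring
  refine ⟨?_, ?_⟩
  · refine lt_of_lt_of_le ?_ hS'
    have hPpos : 0 < P := Real.rpow_pos_of_pos hlpos _
    positivity
  · exact bubble_algebra hc₁ hA2'pos hA2pos.le hC₁ hP0 hK₀0 (by positivity)
      (Real.rpow_nonneg hlpos.le _) hX (hpair (by decide)).1 (hpair (by decide)).2
      (hpair (by decide)).1 (hpair (by decide)).2 hB hQ hS'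

end Summit.CriticalPhenomena.Ising3DConformalLimit.Theorems

end
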